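import Summits.ValiantsHypothesis.ValiantsHypothesis.Theorems.KPlusLogSqLawTropicalBTwoBoundaryQuadratic
import Summits.ValiantsHypothesis.ValiantsHypothesis.Theorems.KPlusLogSqLawTropicalBBoundarySectorMonotone
import Summits.ValiantsHypothesis.ValiantsHypothesis.Theorems.KPlusLogSqLawTropicalBBoundarySectorRelabel

/-!
# Route «KPlusLogSqLaw», crux `TropicalB` (stmt-ValiantsHypothesis-19771) — the LINEAR REGIME of the boundary programme is EXACTLY `B ≤ 1`

HONEST FRAMING.  Proof file (pure corollaries), seat val-sym-trop-p1 g17 (cell `pub-symmetroid`, 2026-08-28), `--supports stmt-ValiantsHypothesis-19771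
--as helper`, toward the registered stubs `stub_tropThin` / `stub_tropFat` of `Cruxes/TropicalB/Lines/birth.lean` (crux `TropicalB`).  Bookkeeping over
landed theorems of the boundary-type sector (`BoundarySector.BoundaryVertexLaw`, val-sym-trop-p1 g2, p447010): `boundaryVertexLaw_zero` / `_one` (g2),
`boundaryVertexLaw_mono` (g2, exponent monotone), `boundaryVertexLaw_of_le` (g2, fewer boundaries), and this seat's `TwoPort.not_boundaryVertexLaw_two_one`
(the two-boundary port of SHIFT-THREE).  Nothing here bounds `TropicalB` in its window; nothing bears on `WeakLifting`, DoorA26 / DoorA34, `MatrixDescartes`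
(stmt-ValiantsHypothesis-18050) or VP ≠ VNP.

* `not_boundaryVertexLaw_one_of_two_le` — `2 ≤ B → ¬ BoundaryVertexLaw B 1` (more boundaries only enlarge the sector);
* `boundaryVertexLaw_one_iff` — **`BoundaryVertexLaw B 1 ↔ B ≤ 1`**: dense boundary-type designs have linearly many dominant terms for NO or ONE
  boundary (g2), and quadratically many as soon as there are two (g17); the exponent of the `B`-boundary sector lies in `[2, 2^B − 1]` for every `B ≥ 2`
  (`boundaryVertexLaw_sharpCounting`), the cell's target `BoundaryVertexLaw 2 2` being the first open value.
-/

set_option linter.dupNamespace false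
set_option autoImplicit false

namespace Summit.ValiantsHypothesis.ValiantsHypothesis.Theorems.KPlusLogSqLaw

namespace BoundarySector

/-- **Two or more boundaries are never linear.** -/
theorem not_boundaryVertexLaw_one_of_two_le {B : ℕ} (hB : 2 ≤ B) : ¬ BoundaryVertexLaw B 1 :=
  fun h => TwoPort.not_boundaryVertexLaw_two_one (boundaryVertexLaw_of_le hB h)

/-- **The linear regime of the boundary programme is exactly `B ≤ 1`.** -/
theorem boundaryVertexLaw_one_iff (B : ℕ) : BoundaryVertexLaw B 1 ↔ B ≤ 1 := by
  constructor
  · intro h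
    by_contra hB
    exact not_boundaryVertexLaw_one_of_two_le (by omega) h
  · intro hB
    rcases Nat.le_one_iff_eq_zero_or_eq_one.mp hB with rfl | rfl
    · exact boundaryVertexLaw_mono zero_le_one boundaryVertexLaw_zero
    · exact boundaryVertexLaw_one

end BoundarySector

end Summit.ValiantsHypothesis.ValiantsHypothesis.Theorems.KPlusLogSqLaw
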